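import Summits.Ventures.CertifiedArithmetic.LowPrec.GemmThetaLawMixCFamilyTraj
import Summits.Ventures.CertifiedArithmetic.LowPrec.GemmTwoBinadeClimb
import HarnessLib

/-!
# GEMM worst case LVII-c — the canonical E3M2·E2M3 family for EVERY precision `p ≥ 13`: the
# accumulator follows `traj7` along the whole prefix (`55297K + 1` roundings, one binade step
# each)

HONEST FRAMING: certified error envelopes and provably optimal rounding/accumulation schemes for
low-precision formats under stated cost models; every table by two implementations; no hardware or
vendor claims.

For a format `φ` with `qexp φ ≤ -7`, `2^(manBits φ + 17) ≤ maxRat φ` and `2^manBits = 4096K`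
(`K = 2^(p-13)`), the family `fam7 K` of file LVII-a (`GemmThetaLawMixCFamilyWord`; every letter
a product of an E3M2 and an E2M3 datum) has the explicit accumulator trajectory `traj7 K`
(`fam7_seqSum`): exact sums up to `2·2^manBits` grid units, every `3/128` is `spacing + tie`
resolved up, in binade `j = 1..13` each letter of the pair `(x_j, 2^j)/128` advances the
accumulator by exactly one grid step (`x_j` exceeds the half-spacing from an even point, `2^j` is
a tie from an odd point resolved up), and the end letter `ω = 130` makes one more step to
`v° = (4096K+1)·256` (value `2^(p+7) + 2^8`).  Method: the binade-step lemma
`rneSigMag_binade_step` (file XLIX-a), the grid bridge `value_step7`, a seventeen-way case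
analysis of the letter index closed by `omega` (`traj7_step`; no `decide` — the precision is a
symbol).  Sequel `GemmThetaLawMixCFamily`: the absorbed tail and the exact relative error.
References: [Higham2002, §4.2], [MullerEtAl2018HFPA, §6.1], [BoldoMelquiond2011Flocq].
-/

namespace Summit.Ventures.CertifiedArithmetic.LowPrec.Gemm

open Literature.ComputerArithmetic.FloatingPoint
open Literature.ComputerArithmetic.FloatingPoint.MiniFloat
open Literature.ComputerArithmetic.FloatingPoint.MiniFloat.TieChain (seqSum_orbitFn)
open Finset

variable {φ : Format}

section Steps

variable (hq : φ.qexp ≤ -7) (hR : (2 : ℚ) ^ (φ.manBits + 17) ≤ φ.maxRat)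
  {K : ℕ} (hM : 2 ^ φ.manBits = 4096 * K)
include hq hR hM

/-- THE PREFIX ROUNDINGS (seventeen cases of the letter index, each one binade step):
`fl_φ(traj7 k + fam7 (k+1)) = traj7 (k+1)` for every `k < 55297K`, and the step is in range.
[cell] -/
theorem traj7_step (k : ℕ) (hk : k < 55297 * K) :
    (roundNE φ (traj7 K k + fam7 K (k + 1))).toRat = traj7 K (k + 1) ∧
      |traj7 K k + fam7 K (k + 1)| ≤ φ.maxRat := by
  obtain ⟨hK1, hpow, hpow1⟩ := pow_facts7 hM
  have h2 : 2 ∣ 4096 * K := ⟨2048 * K, by ring⟩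
  unfold traj7 fam7
  rcases (by omega : k + 2 < K ∨ k + 2 = K ∨ (K ≤ k + 1 ∧ k + 2 ≤ 2049 * K) ∨
      (2049 * K ≤ k + 1 ∧ k + 2 ≤ 6145 * K) ∨ (6145 * K ≤ k + 1 ∧ k + 2 ≤ 10241 * K) ∨
      (10241 * K ≤ k + 1 ∧ k + 2 ≤ 14337 * K) ∨ (14337 * K ≤ k + 1 ∧ k + 2 ≤ 18433 * K) ∨
      (18433 * K ≤ k + 1 ∧ k + 2 ≤ 22529 * K) ∨ (22529 * K ≤ k + 1 ∧ k + 2 ≤ 26625 * K) ∨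
      (26625 * K ≤ k + 1 ∧ k + 2 ≤ 30721 * K) ∨ (30721 * K ≤ k + 1 ∧ k + 2 ≤ 34817 * K) ∨
      (34817 * K ≤ k + 1 ∧ k + 2 ≤ 38913 * K) ∨ (38913 * K ≤ k + 1 ∧ k + 2 ≤ 43009 * K) ∨
      (43009 * K ≤ k + 1 ∧ k + 2 ≤ 47105 * K) ∨ (47105 * K ≤ k + 1 ∧ k + 2 ≤ 51201 * K) ∨
      (51201 * K ≤ k + 1 ∧ k + 2 ≤ 55297 * K) ∨ (55297 * K ≤ k + 1 ∧ k + 2 ≤ 55297 * K + 1)) with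
      h | h | h | h | h | h | h | h | h | h | h | h | h | h | h | h | h
  · -- exact prefix: `8192(k+2) < 8192K = 2^(m+1)`
    refine value_step7 hq hR (n := 8192 * k + 16384) ?_ (by omega) ?_
    · rw [traj7N_P (by omega), fam7Z_P (by omega)]; push_cast; omega
    · rw [traj7N_P (by omega), rneSigMag_of_lt (by rw [hpow1]; omega)]; omega
  · -- the last `64` lands exactly on `2^(m+1) = (4096K + 0)·2 + 0` (binade 0, `r = 0`)
    refine value_step7 hq hR (n := (4096 * K + 0) * 2 + 0) ?_ (by omega) ?_
    · rw [traj7N_P (by omega), fam7Z_P (by omega)]; push_cast; omega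
    · rw [traj7N_P (by omega), rneSigMag_binade_step (j := 0) hM h2 (by norm_num) (by omega)
        (by norm_num)]
      simp [stepUp]; omega
  · -- binade 0, letter `3 = spacing + 1` from an even point: a tie at an odd `t`, resolved up
    refine value_step7 hq hR (n := (4096 * K + (2 * k + 3 - 2 * K)) * 2 + 1) ?_ (by omega) ?_
    · rw [traj7N_B0 (by omega) (by omega), fam7Z_B0 (by omega) (by omega)]; push_cast; omega
    · rw [traj7N_B0 (by omega) (by omega), rneSigMag_binade_step (j := 0) hM h2 (by norm_num)
        (by omega) (by norm_num)]
      simp [stepUp]; omega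
  · obtain ⟨e, he, hek⟩ : ∃ e, e < 4096 * K ∧ k + 1 = 2049 * K + e :=  -- binade 1
      ⟨k + 1 - 2049 * K, by omega, by omega⟩
    rcases Nat.mod_two_eq_zero_or_one e with hp | hp
    · refine value_step7 hq hR (n := (4096 * K + e) * 4 + 3) ?_ (by omega) ?_
      · rw [traj7N_T1 (by omega) (by omega), hek, fam7Z_B1 K e he, pairZ_even _ _ hp]
        push_cast; omega
      · rw [traj7N_T1 (by omega) (by omega), rneSigMag_binade_step (j := 1) hM h2 (by norm_num)
          (by omega) (by norm_num)]
        simp [stepUp]; omega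
    · refine value_step7 hq hR (n := (4096 * K + e) * 4 + 2) ?_ (by omega) ?_
      · rw [traj7N_T1 (by omega) (by omega), hek, fam7Z_B1 K e he, pairZ_odd _ _ hp]
        push_cast; omega
      · rw [traj7N_T1 (by omega) (by omega), rneSigMag_binade_step (j := 1) hM h2 (by norm_num)
          (by omega) (by norm_num)]
        simp [stepUp]; omega
  · obtain ⟨e, he, hek⟩ : ∃ e, e < 4096 * K ∧ k + 1 = 6145 * K + e :=  -- binade 2
      ⟨k + 1 - 6145 * K, by omega, by omega⟩
    rcases Nat.mod_two_eq_zero_or_one e with hp | hp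
    · refine value_step7 hq hR (n := (4096 * K + e) * 8 + 5) ?_ (by omega) ?_
      · rw [traj7N_T2 (by omega) (by omega), hek, fam7Z_B2 K e he, pairZ_even _ _ hp]
        push_cast; omega
      · rw [traj7N_T2 (by omega) (by omega), rneSigMag_binade_step (j := 2) hM h2 (by norm_num)
          (by omega) (by norm_num)]
        simp [stepUp]; omega
    · refine value_step7 hq hR (n := (4096 * K + e) * 8 + 4) ?_ (by omega) ?_
      · rw [traj7N_T2 (by omega) (by omega), hek, fam7Z_B2 K e he, pairZ_odd _ _ hp]
        push_cast; omega
      · rw [traj7N_T2 (by omega) (by omega), rneSigMag_binade_step (j := 2) hM h2 (by norm_num)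
          (by omega) (by norm_num)]
        simp [stepUp]; omega
  · obtain ⟨e, he, hek⟩ : ∃ e, e < 4096 * K ∧ k + 1 = 10241 * K + e :=  -- binade 3
      ⟨k + 1 - 10241 * K, by omega, by omega⟩
    rcases Nat.mod_two_eq_zero_or_one e with hp | hp
    · refine value_step7 hq hR (n := (4096 * K + e) * 16 + 9) ?_ (by omega) ?_
      · rw [traj7N_T3 (by omega) (by omega), hek, fam7Z_B3 K e he, pairZ_even _ _ hp]
        push_cast; omega
      · rw [traj7N_T3 (by omega) (by omega), rneSigMag_binade_step (j := 3) hM h2 (by norm_num)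
          (by omega) (by norm_num)]
        simp [stepUp]; omega
    · refine value_step7 hq hR (n := (4096 * K + e) * 16 + 8) ?_ (by omega) ?_
      · rw [traj7N_T3 (by omega) (by omega), hek, fam7Z_B3 K e he, pairZ_odd _ _ hp]
        push_cast; omega
      · rw [traj7N_T3 (by omega) (by omega), rneSigMag_binade_step (j := 3) hM h2 (by norm_num)
          (by omega) (by norm_num)]
        simp [stepUp]; omega
  · obtain ⟨e, he, hek⟩ : ∃ e, e < 4096 * K ∧ k + 1 = 14337 * K + e :=  -- binade 4
      ⟨k + 1 - 14337 * K, by omega, by omega⟩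
    rcases Nat.mod_two_eq_zero_or_one e with hp | hp
    · refine value_step7 hq hR (n := (4096 * K + e) * 32 + 18) ?_ (by omega) ?_
      · rw [traj7N_T4 (by omega) (by omega), hek, fam7Z_B4 K e he, pairZ_even _ _ hp]
        push_cast; omega
      · rw [traj7N_T4 (by omega) (by omega), rneSigMag_binade_step (j := 4) hM h2 (by norm_num)
          (by omega) (by norm_num)]
        simp [stepUp]; omega
    · refine value_step7 hq hR (n := (4096 * K + e) * 32 + 16) ?_ (by omega) ?_
      · rw [traj7N_T4 (by omega) (by omega), hek, fam7Z_B4 K e he, pairZ_odd _ _ hp]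
        push_cast; omega
      · rw [traj7N_T4 (by omega) (by omega), rneSigMag_binade_step (j := 4) hM h2 (by norm_num)
          (by omega) (by norm_num)]
        simp [stepUp]; omega
  · obtain ⟨e, he, hek⟩ : ∃ e, e < 4096 * K ∧ k + 1 = 18433 * K + e :=  -- binade 5
      ⟨k + 1 - 18433 * K, by omega, by omega⟩
    rcases Nat.mod_two_eq_zero_or_one e with hp | hp
    · refine value_step7 hq hR (n := (4096 * K + e) * 64 + 33) ?_ (by omega) ?_
      · rw [traj7N_T5 (by omega) (by omega), hek, fam7Z_B5 K e he, pairZ_even _ _ hp]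
        push_cast; omega
      · rw [traj7N_T5 (by omega) (by omega), rneSigMag_binade_step (j := 5) hM h2 (by norm_num)
          (by omega) (by norm_num)]
        simp [stepUp]; omega
    · refine value_step7 hq hR (n := (4096 * K + e) * 64 + 32) ?_ (by omega) ?_
      · rw [traj7N_T5 (by omega) (by omega), hek, fam7Z_B5 K e he, pairZ_odd _ _ hp]
        push_cast; omega
      · rw [traj7N_T5 (by omega) (by omega), rneSigMag_binade_step (j := 5) hM h2 (by norm_num)
          (by omega) (by norm_num)]
        simp [stepUp]; omega
  · obtain ⟨e, he, hek⟩ : ∃ e, e < 4096 * K ∧ k + 1 = 22529 * K + e :=  -- binade 6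
      ⟨k + 1 - 22529 * K, by omega, by omega⟩
    rcases Nat.mod_two_eq_zero_or_one e with hp | hp
    · refine value_step7 hq hR (n := (4096 * K + e) * 128 + 65) ?_ (by omega) ?_
      · rw [traj7N_T6 (by omega) (by omega), hek, fam7Z_B6 K e he, pairZ_even _ _ hp]
        push_cast; omega
      · rw [traj7N_T6 (by omega) (by omega), rneSigMag_binade_step (j := 6) hM h2 (by norm_num)
          (by omega) (by norm_num)]
        simp [stepUp]; omega
    · refine value_step7 hq hR (n := (4096 * K + e) * 128 + 64) ?_ (by omega) ?_
      · rw [traj7N_T6 (by omega) (by omega), hek, fam7Z_B6 K e he, pairZ_odd _ _ hp]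
        push_cast; omega
      · rw [traj7N_T6 (by omega) (by omega), rneSigMag_binade_step (j := 6) hM h2 (by norm_num)
          (by omega) (by norm_num)]
        simp [stepUp]; omega
  · obtain ⟨e, he, hek⟩ : ∃ e, e < 4096 * K ∧ k + 1 = 26625 * K + e :=  -- binade 7
      ⟨k + 1 - 26625 * K, by omega, by omega⟩
    rcases Nat.mod_two_eq_zero_or_one e with hp | hp
    · refine value_step7 hq hR (n := (4096 * K + e) * 256 + 130) ?_ (by omega) ?_
      · rw [traj7N_T7 (by omega) (by omega), hek, fam7Z_B7 K e he, pairZ_even _ _ hp]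
        push_cast; omega
      · rw [traj7N_T7 (by omega) (by omega), rneSigMag_binade_step (j := 7) hM h2 (by norm_num)
          (by omega) (by norm_num)]
        simp [stepUp]; omega
    · refine value_step7 hq hR (n := (4096 * K + e) * 256 + 128) ?_ (by omega) ?_
      · rw [traj7N_T7 (by omega) (by omega), hek, fam7Z_B7 K e he, pairZ_odd _ _ hp]
        push_cast; omega
      · rw [traj7N_T7 (by omega) (by omega), rneSigMag_binade_step (j := 7) hM h2 (by norm_num)
          (by omega) (by norm_num)]
        simp [stepUp]; omega
  · obtain ⟨e, he, hek⟩ : ∃ e, e < 4096 * K ∧ k + 1 = 30721 * K + e :=  -- binade 8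
      ⟨k + 1 - 30721 * K, by omega, by omega⟩
    rcases Nat.mod_two_eq_zero_or_one e with hp | hp
    · refine value_step7 hq hR (n := (4096 * K + e) * 512 + 260) ?_ (by omega) ?_
      · rw [traj7N_T8 (by omega) (by omega), hek, fam7Z_B8 K e he, pairZ_even _ _ hp]
        push_cast; omega
      · rw [traj7N_T8 (by omega) (by omega), rneSigMag_binade_step (j := 8) hM h2 (by norm_num)
          (by omega) (by norm_num)]
        simp [stepUp]; omega
    · refine value_step7 hq hR (n := (4096 * K + e) * 512 + 256) ?_ (by omega) ?_
      · rw [traj7N_T8 (by omega) (by omega), hek, fam7Z_B8 K e he, pairZ_odd _ _ hp]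
        push_cast; omega
      · rw [traj7N_T8 (by omega) (by omega), rneSigMag_binade_step (j := 8) hM h2 (by norm_num)
          (by omega) (by norm_num)]
        simp [stepUp]; omega
  · obtain ⟨e, he, hek⟩ : ∃ e, e < 4096 * K ∧ k + 1 = 34817 * K + e :=  -- binade 9
      ⟨k + 1 - 34817 * K, by omega, by omega⟩
    rcases Nat.mod_two_eq_zero_or_one e with hp | hp
    · refine value_step7 hq hR (n := (4096 * K + e) * 1024 + 520) ?_ (by omega) ?_
      · rw [traj7N_T9 (by omega) (by omega), hek, fam7Z_B9 K e he, pairZ_even _ _ hp]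
        push_cast; omega
      · rw [traj7N_T9 (by omega) (by omega), rneSigMag_binade_step (j := 9) hM h2 (by norm_num)
          (by omega) (by norm_num)]
        simp [stepUp]; omega
    · refine value_step7 hq hR (n := (4096 * K + e) * 1024 + 512) ?_ (by omega) ?_
      · rw [traj7N_T9 (by omega) (by omega), hek, fam7Z_B9 K e he, pairZ_odd _ _ hp]
        push_cast; omega
      · rw [traj7N_T9 (by omega) (by omega), rneSigMag_binade_step (j := 9) hM h2 (by norm_num)
          (by omega) (by norm_num)]
        simp [stepUp]; omega
  · obtain ⟨e, he, hek⟩ : ∃ e, e < 4096 * K ∧ k + 1 = 38913 * K + e :=  -- binade 10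
      ⟨k + 1 - 38913 * K, by omega, by omega⟩
    rcases Nat.mod_two_eq_zero_or_one e with hp | hp
    · refine value_step7 hq hR (n := (4096 * K + e) * 2048 + 1040) ?_ (by omega) ?_
      · rw [traj7N_T10 (by omega) (by omega), hek, fam7Z_B10 K e he, pairZ_even _ _ hp]
        push_cast; omega
      · rw [traj7N_T10 (by omega) (by omega), rneSigMag_binade_step (j := 10) hM h2 (by norm_num)
          (by omega) (by norm_num)]
        simp [stepUp]; omega
    · refine value_step7 hq hR (n := (4096 * K + e) * 2048 + 1024) ?_ (by omega) ?_
      · rw [traj7N_T10 (by omega) (by omega), hek, fam7Z_B10 K e he, pairZ_odd _ _ hp]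
        push_cast; omega
      · rw [traj7N_T10 (by omega) (by omega), rneSigMag_binade_step (j := 10) hM h2 (by norm_num)
          (by omega) (by norm_num)]
        simp [stepUp]; omega
  · obtain ⟨e, he, hek⟩ : ∃ e, e < 4096 * K ∧ k + 1 = 43009 * K + e :=  -- binade 11
      ⟨k + 1 - 43009 * K, by omega, by omega⟩
    rcases Nat.mod_two_eq_zero_or_one e with hp | hp
    · refine value_step7 hq hR (n := (4096 * K + e) * 4096 + 2080) ?_ (by omega) ?_
      · rw [traj7N_T11 (by omega) (by omega), hek, fam7Z_B11 K e he, pairZ_even _ _ hp]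
        push_cast; omega
      · rw [traj7N_T11 (by omega) (by omega), rneSigMag_binade_step (j := 11) hM h2 (by norm_num)
          (by omega) (by norm_num)]
        simp [stepUp]; omega
    · refine value_step7 hq hR (n := (4096 * K + e) * 4096 + 2048) ?_ (by omega) ?_
      · rw [traj7N_T11 (by omega) (by omega), hek, fam7Z_B11 K e he, pairZ_odd _ _ hp]
        push_cast; omega
      · rw [traj7N_T11 (by omega) (by omega), rneSigMag_binade_step (j := 11) hM h2 (by norm_num)
          (by omega) (by norm_num)]
        simp [stepUp]; omega
  · obtain ⟨e, he, hek⟩ : ∃ e, e < 4096 * K ∧ k + 1 = 47105 * K + e :=  -- binade 12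
      ⟨k + 1 - 47105 * K, by omega, by omega⟩
    rcases Nat.mod_two_eq_zero_or_one e with hp | hp
    · refine value_step7 hq hR (n := (4096 * K + e) * 8192 + 4160) ?_ (by omega) ?_
      · rw [traj7N_T12 (by omega) (by omega), hek, fam7Z_B12 K e he, pairZ_even _ _ hp]
        push_cast; omega
      · rw [traj7N_T12 (by omega) (by omega), rneSigMag_binade_step (j := 12) hM h2 (by norm_num)
          (by omega) (by norm_num)]
        simp [stepUp]; omega
    · refine value_step7 hq hR (n := (4096 * K + e) * 8192 + 4096) ?_ (by omega) ?_
      · rw [traj7N_T12 (by omega) (by omega), hek, fam7Z_B12 K e he, pairZ_odd _ _ hp]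
        push_cast; omega
      · rw [traj7N_T12 (by omega) (by omega), rneSigMag_binade_step (j := 12) hM h2 (by norm_num)
          (by omega) (by norm_num)]
        simp [stepUp]; omega
  · obtain ⟨e, he, hek⟩ : ∃ e, e < 4096 * K ∧ k + 1 = 51201 * K + e :=  -- binade 13
      ⟨k + 1 - 51201 * K, by omega, by omega⟩
    rcases Nat.mod_two_eq_zero_or_one e with hp | hp
    · refine value_step7 hq hR (n := (4096 * K + e) * 16384 + 8320) ?_ (by omega) ?_
      · rw [traj7N_T13 (by omega) (by omega), hek, fam7Z_B13 K e he, pairZ_even _ _ hp]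
        push_cast; omega
      · rw [traj7N_T13 (by omega) (by omega), rneSigMag_binade_step (j := 13) hM h2 (by norm_num)
          (by omega) (by norm_num)]
        simp [stepUp]; omega
    · refine value_step7 hq hR (n := (4096 * K + e) * 16384 + 8192) ?_ (by omega) ?_
      · rw [traj7N_T13 (by omega) (by omega), hek, fam7Z_B13 K e he, pairZ_odd _ _ hp]
        push_cast; omega
      · rw [traj7N_T13 (by omega) (by omega), rneSigMag_binade_step (j := 13) hM h2 (by norm_num)
          (by omega) (by norm_num)]
        simp [stepUp]; omega
  · obtain ⟨e, he, hek⟩ : ∃ e, e < 1 ∧ k + 1 = 55297 * K + e :=  -- binade 14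
      ⟨k + 1 - 55297 * K, by omega, by omega⟩
    rcases Nat.mod_two_eq_zero_or_one e with hp | hp
    · refine value_step7 hq hR (n := (4096 * K + e) * 32768 + 16640) ?_ (by omega) ?_
      · rw [traj7N_T14 (by omega) (by omega), hek, fam7Z_B14 K e he, pairZ_even _ _ hp]
        push_cast; omega
      · rw [traj7N_T14 (by omega) (by omega), rneSigMag_binade_step (j := 14) hM h2 (by norm_num)
          (by omega) (by norm_num)]
        simp [stepUp]; omega
    · refine value_step7 hq hR (n := (4096 * K + e) * 32768 + 16384) ?_ (by omega) ?_
      · rw [traj7N_T14 (by omega) (by omega), hek, fam7Z_B14 K e he, pairZ_odd _ _ hp]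
        push_cast; omega
      · rw [traj7N_T14 (by omega) (by omega), rneSigMag_binade_step (j := 14) hM h2 (by norm_num)
          (by omega) (by norm_num)]
        simp [stepUp]; omega

/-- `ŝ₀ = 64` (for `K = 1` the first letter is `2^(m+1)` itself). [cell] -/
theorem fam7_s0 : (seqSum φ (fam7 K) 0).toRat = traj7 K 0 := by
  obtain ⟨hK1, hpow, hpow1⟩ := pow_facts7 hM
  show (roundNE φ (fam7 K 0)).toRat = traj7 K 0
  unfold fam7 traj7
  rw [fam7Z_P (by omega), traj7N_P (by omega)]
  have hr : rneSigMag φ.manBits 8192 = 8192 := by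
    rcases Nat.lt_or_ge 8192 (2 ^ (φ.manBits + 1)) with h | h
    · exact rneSigMag_of_lt h
    · have hK : K = 1 := by rw [hpow1] at h; omega
      subst hK
      have h' := rneSigMag_binade_step (t := 0) (r := 0) (j := 0) (u := 2) hM ⟨2048, rfl⟩
        (by norm_num) (by norm_num) (by norm_num)
      simpa [stepUp] using h'
  have h := roundNE_grid7_nat hq hR (n := 8192) (by omega)
  rw [hr] at h
  push_cast at h ⊢
  simpa using h

/-- THE ACCUMULATOR FOLLOWS `traj7` ALONG THE WHOLE PREFIX. [cell] -/
theorem fam7_seqSum : ∀ k ≤ 55297 * K, (seqSum φ (fam7 K) k).toRat = traj7 K k := by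
  intro k hk
  have h := seqSum_orbitFn (α := φ) (fam7 K) 0 (55297 * K) (fun j => fam7 K (j + 1)) (traj7 K)
    (fun j _ => by rw [Nat.zero_add]) (fam7_s0 hq hR hM)
    (fun j hj => (traj7_step hq hR hM j hj).1) k hk
  rwa [Nat.zero_add] at h

/-- The prefix stays in range. [cell] -/
theorem fam7_inRange_prefix : InRange φ (fam7 K) (55297 * K) := by
  obtain ⟨hK1, hpow, -⟩ := pow_facts7 hM
  refine ⟨?_, fun k hk => ?_⟩
  · unfold fam7; rw [fam7Z_P (by omega), abs_of_nonneg (by positivity)]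
    exact le_trans (by norm_num) (grid7_le_maxRat hR (n := 8192) (by omega))
  · rw [fam7_seqSum hq hR hM k (le_of_lt hk)]
    exact (traj7_step hq hR hM k hk).2

end Steps

end Summit.Ventures.CertifiedArithmetic.LowPrec.Gemm
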